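import Summits.CriticalPhenomena.PercolationContinuityZ3.Theorems.PercNearOneGluingNoHeavyLowerTailSahiCTCLadderThreeStatus
import Summits.CriticalPhenomena.PercolationContinuityZ3.Theorems.PercNearOneGluingNoHeavyLowerTailSahiCTCLadderThreeRowOne
import Summits.CriticalPhenomena.PercolationContinuityZ3.Theorems.PercNearOneGluingNoHeavyLowerTailSahiCTCLadderThreeRowTwo
import HarnessLib

/-!
# `NoHeavyLowerTail` (crux stmt-CriticalPhenomena-4575), P3 lane: the level-3 ladder `(L_3)` at every profile with `τ ≥ 18`

Support file (seat `prim-l12-p3`, gen 26; `--supports stmt-CriticalPhenomena-4575`).  Memo g26 §4.  For 3-live up-sets `𝒳, 𝒵` the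
coefficient of the ladder form `L_3 = e_3·(Π·GF(𝒳∩𝒵) − GF(𝒳)GF(𝒵)) − Θ_2·e_{≥3}·GF((𝒳∩𝒵)_3)` at a profile `m` is nonnegative as soon
as `m` has at least 18 points of multiplicity one: all five rows — exponent ≥ 3 / no doubled point / ≥ 5 doubled points
(`coeff_ladder_three_nonneg_of_not_Drow`), four (`…rowFour…`, `τ ≥ 2`), three (`…rowThree…`, `τ ≥ 18`), two (`…rowTwo…`, `τ ≥ 9`,
PINNED density) and one doubled point (`…rowOne…`, `τ ≥ 7`, PINNED density).  **`coeff_ladder_three_nonneg`**.  What remains of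
`(L_3)` coefficientwise is the finite list of small profiles (`τ ≤ 17`).  Nothing is asserted about the crux.
-/

namespace Summit.CriticalPhenomena.PercolationContinuityZ3.Theorems.SahiCTCForms

open Finset MvPolynomial SahiCTCGenFun SahiCTCWeightedLYM

variable {α : Type*} [DecidableEq α] [Fintype α]

/-- **`(L_3)` at every profile with `τ ≥ 18`**: for 3-live up-sets `𝒳, 𝒵` and any profile `m` with `#(lev m 1) ≥ 18`,
`0 ≤ [m] (e_3·(Π·GF(𝒳∩𝒵) − GF 𝒳·GF 𝒵) − Θ_2·e_{≥3}·GF((𝒳∩𝒵)_3))`. [this work] -/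
theorem coeff_ladder_three_nonneg {𝒳 𝒵 : Finset (Finset α)} (h𝒳 : IsUpperSet (𝒳 : Set (Finset α)))
    (h𝒵 : IsUpperSet (𝒵 : Set (Finset α))) (hX3 : ∀ S ∈ 𝒳, 3 ≤ #S) (hZ3 : ∀ S ∈ 𝒵, 3 ≤ #S) (m : α →₀ ℕ)
    (hτ : 18 ≤ #(lev m 1)) :
    0 ≤ (ee 3 * (PiP * gf (𝒳 ∩ 𝒵) - gf 𝒳 * gf 𝒵) -
      gf (bySize (· ≤ 3 - 1) : Finset (Finset α)) * gf (bySize (3 ≤ ·) : Finset (Finset α)) *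
        gf ((𝒳 ∩ 𝒵).filter fun S => #S = 3)).coeff m := by
  by_cases hbig : ∃ i, 3 ≤ m i
  · exact coeff_ladder_three_nonneg_of_settled_row h𝒳 h𝒵 hX3 hZ3 m (Or.inl hbig) (fun _ _ => hτ) (fun _ _ => by omega)
  have hm : ∀ i, m i ≤ 2 := fun i => by by_contra h; exact hbig ⟨i, by omega⟩
  by_cases hD1 : #(dbl m) = 1
  · exact coeff_ladder_three_rowOne_nonneg h𝒳 h𝒵 hX3 hZ3 hm hD1 (by omega)
  by_cases hD2 : #(dbl m) = 2
  · exact coeff_ladder_three_rowTwo_nonneg h𝒳 h𝒵 hX3 hZ3 hm hD2 (by omega)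
  exact coeff_ladder_three_nonneg_of_settled_row h𝒳 h𝒵 hX3 hZ3 m (Or.inr ⟨hD1, hD2⟩) (fun _ _ => hτ) (fun _ _ => by omega)

end Summit.CriticalPhenomena.PercolationContinuityZ3.Theorems.SahiCTCForms
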